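import Mathlib.Analysis.SpecialFunctions.Integrals.Basic
import Mathlib.Analysis.SpecialFunctions.Sqrt
import HarnessLib

/-!
# Caloric fixed point — part C: the time weight and three elementary integrals
(helpers of the line lead for `stub_caloricFixedPoint`, crux `SmallFieldUltracontractivity`,
item stmt-QuantumFields-8871, line `point-centred-axial-parabolic`)

* The polynomial time weight of the cut-off Duhamel step, `θ_s(τ) = 1 − (4(s−τ)/(3s))²`, with
  `θ_s(s/4) = 0`, `θ_s(s) = 1`, `0 ≤ θ_s ≤ 1` and `0 ≤ θ_s' = (32/(9s²))(s − τ)` on `[s/4, s]`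
  (so that `θ_s'(τ)/(1 + s − τ) ≤ 32/(9s²)`: no logarithm in the free term).
* `∫₀ᵀ |m| e^{−cσm²} dσ ≤ √(T/c)` (the mass cross-term is paid by the massive decay of the free kernel),
  `∫₀ᵀ dσ/√(1+σ) ≤ 2√(1+T)` (the smoothing gain is integrable), both by the fundamental theorem of calculus.

Pure Mathlib.
-/

noncomputable section

namespace Summit.QuantumFields.QCD.Cruxes.SmallFieldUltracontractivity.PointCentredAxialParabolic

open MeasureTheory intervalIntegral Real

/-! ### The time weight `θ_s` -/

/-- `θ_s` is differentiable with derivative `(32/(9s²))(s − τ)`. -/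
theorem hasDerivAt_timeWeight (s τ : ℝ) :
    HasDerivAt (fun τ : ℝ => 1 - (4 * (s - τ) / (3 * s)) ^ 2) (32 / (9 * s ^ 2) * (s - τ)) τ := by
  rcases eq_or_ne s 0 with rfl | hs
  · simp only [mul_zero, div_zero, zero_pow (two_ne_zero), sub_zero, zero_sub, mul_neg, zero_mul]
    simpa using hasDerivAt_const τ (1 : ℝ)
  · have h1 : HasDerivAt (fun τ : ℝ => 4 * (s - τ) / (3 * s)) (4 * -1 / (3 * s)) τ :=
      (((hasDerivAt_id' τ).const_sub s).const_mul 4).div_const (3 * s)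
    have h2 := (h1.fun_pow 2).const_sub 1
    refine h2.congr_deriv ?_
    norm_num
    field_simp
    ring

/-- `θ_s(s) = 1`. -/
theorem timeWeight_self (s : ℝ) : 1 - (4 * (s - s) / (3 * s)) ^ 2 = 1 := by simp

/-- `θ_s(s/4) = 0` (`s ≠ 0`). -/
theorem timeWeight_quarter {s : ℝ} (hs : s ≠ 0) : 1 - (4 * (s - s / 4) / (3 * s)) ^ 2 = 0 := by
  field_simp
  ring

/-- On `[s/4, s]` (`s > 0`): `0 ≤ θ_s ≤ 1`. -/
theorem timeWeight_mem_Icc {s τ : ℝ} (hs : 0 < s) (h1 : s / 4 ≤ τ) (h2 : τ ≤ s) :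
    0 ≤ 1 - (4 * (s - τ) / (3 * s)) ^ 2 ∧ 1 - (4 * (s - τ) / (3 * s)) ^ 2 ≤ 1 := by
  have hu0 : 0 ≤ 4 * (s - τ) / (3 * s) := div_nonneg (by linarith) (by linarith)
  have hu1 : 4 * (s - τ) / (3 * s) ≤ 1 := by
    rw [div_le_one (by linarith)]
    linarith
  have hsq : (4 * (s - τ) / (3 * s)) ^ 2 ≤ 1 := by nlinarith
  exact ⟨by linarith, by nlinarith⟩

/-- On `[s/4, s]` (`s > 0`): `0 ≤ θ_s' ≤ (32/(9s²))(s − τ)` (the second inequality is an equality) and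
`θ_s'(τ) ≤ 32/(9 s²) · (1 + s − τ)`, so `θ_s'/(1 + s − τ) ≤ 32/(9s²)`. -/
theorem timeWeight_deriv_bounds {s τ : ℝ} (hs : 0 < s) (h2 : τ ≤ s) :
    0 ≤ 32 / (9 * s ^ 2) * (s - τ) ∧ 32 / (9 * s ^ 2) * (s - τ) / (1 + s - τ) ≤ 32 / (9 * s ^ 2) := by
  have hst : 0 ≤ s - τ := by linarith
  refine ⟨by positivity, ?_⟩
  rw [div_le_iff₀ (by linarith)]
  have : 0 ≤ 32 / (9 * s ^ 2) := by positivity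
  nlinarith

/-! ### Three elementary integrals -/

/-- **The mass integral**: for `c > 0`, `T ≥ 0` and every real `m`,
`∫₀ᵀ |m| e^{−cσm²} dσ ≤ √(T/c)` (for `m ≠ 0` the integral is `(1 − e^{−cTm²})/(c|m|)`, and
`1 − e^{−y} ≤ min(1, y)`). -/
theorem integral_abs_mul_exp_neg_le {c T : ℝ} (hc : 0 < c) (hT : 0 ≤ T) (m : ℝ) :
    ∫ σ in (0:ℝ)..T, |m| * Real.exp (-(c * σ * m ^ 2)) ≤ Real.sqrt (T / c) := by
  rcases eq_or_ne m 0 with rfl | hm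
  · simp only [abs_zero, zero_mul, intervalIntegral.integral_zero]
    positivity
  · have hm2 : 0 < m ^ 2 := by positivity
    have hcm : 0 < c * m ^ 2 := mul_pos hc hm2
    -- antiderivative `Φ(σ) = -e^{-c m² σ}/(c m²)` of `e^{-cσm²}`
    have hderiv : ∀ σ : ℝ, HasDerivAt (fun σ => -Real.exp (-(c * σ * m ^ 2)) / (c * m ^ 2))
        (Real.exp (-(c * σ * m ^ 2))) σ := by
      intro σ
      have h1 : HasDerivAt (fun σ : ℝ => -(c * σ * m ^ 2)) (-(c * m ^ 2)) σ :=
        ((((hasDerivAt_id' σ).const_mul c).mul_const (m ^ 2)).fun_neg).congr_deriv (by ring)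
      have h2 := h1.exp
      have h3 := (h2.fun_neg).div_const (c * m ^ 2)
      refine h3.congr_deriv ?_
      field_simp
    have hint : ∫ σ in (0:ℝ)..T, Real.exp (-(c * σ * m ^ 2)) =
        (-Real.exp (-(c * T * m ^ 2)) / (c * m ^ 2)) - (-Real.exp (-(c * 0 * m ^ 2)) / (c * m ^ 2)) :=
      integral_eq_sub_of_hasDerivAt (fun σ _ => hderiv σ)
        ((Continuous.intervalIntegrable (by fun_prop) _ _))
    rw [intervalIntegral.integral_const_mul, hint]
    simp only [mul_zero, zero_mul, neg_zero, Real.exp_zero]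
    have hval : |m| * (-Real.exp (-(c * T * m ^ 2)) / (c * m ^ 2) - -1 / (c * m ^ 2)) =
        (1 - Real.exp (-(c * T * m ^ 2))) / (c * |m|) := by
      have hm' : |m| ≠ 0 := abs_ne_zero.mpr hm
      have : m ^ 2 = |m| ^ 2 := (sq_abs m).symm
      rw [this]
      field_simp
      ring
    rw [hval]
    -- `1 - e^{-y} ≤ min 1 y` with `y = c T m²`
    set y := c * T * m ^ 2 with hy
    have hy0 : 0 ≤ y := by positivity
    have hA : 1 - Real.exp (-y) ≤ 1 := by linarith [Real.exp_pos (-y)]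
    have hB : 1 - Real.exp (-y) ≤ y := by linarith [Real.add_one_le_exp (-y)]
    have hcm' : 0 < c * |m| := mul_pos hc (abs_pos.mpr hm)
    -- compare squares: `((1-e^{-y})/(c|m|))² ≤ (1/(c|m|))·(y/(c|m|)) = T/c`
    have hnonneg : 0 ≤ (1 - Real.exp (-y)) / (c * |m|) :=
      div_nonneg (by linarith [Real.exp_le_one_iff.mpr (by linarith : -y ≤ 0)]) hcm'.le
    rw [← Real.sqrt_sq hnonneg]
    refine Real.sqrt_le_sqrt ?_
    rw [div_pow, sq]
    have h1e : 0 ≤ 1 - Real.exp (-y) := by linarith [Real.exp_le_one_iff.mpr (by linarith : -y ≤ 0)]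
    have hprod : (1 - Real.exp (-y)) * (1 - Real.exp (-y)) ≤ 1 * y :=
      mul_le_mul hA hB h1e zero_le_one
    calc (1 - Real.exp (-y)) * (1 - Real.exp (-y)) / (c * |m|) ^ 2
        ≤ 1 * y / (c * |m|) ^ 2 := div_le_div_of_nonneg_right hprod (by positivity)
      _ = T / c := by
          rw [hy, mul_pow, sq_abs]
          field_simp

/-- **The smoothing integral**: `∫₀ᵀ dσ/√(1+σ) ≤ 2√(1+T)` for `T ≥ 0`. -/
theorem integral_inv_sqrt_one_add_le {T : ℝ} (hT : 0 ≤ T) :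
    ∫ σ in (0:ℝ)..T, 1 / Real.sqrt (1 + σ) ≤ 2 * Real.sqrt (1 + T) := by
  have hderiv : ∀ σ ∈ Set.uIcc (0:ℝ) T, HasDerivAt (fun σ => 2 * Real.sqrt (1 + σ)) (1 / Real.sqrt (1 + σ)) σ := by
    intro σ hσ
    rw [Set.uIcc_of_le hT] at hσ
    have hpos : 0 < 1 + σ := by linarith [hσ.1]
    have h1 : HasDerivAt (fun σ : ℝ => 1 + σ) 1 σ := (hasDerivAt_id' σ).const_add 1
    have h2 := (h1.sqrt hpos.ne').const_mul 2
    refine h2.congr_deriv ?_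
    have : Real.sqrt (1 + σ) ≠ 0 := (Real.sqrt_pos.mpr hpos).ne'
    field_simp
  have hcont : ContinuousOn (fun σ : ℝ => 1 / Real.sqrt (1 + σ)) (Set.uIcc 0 T) := by
    rw [Set.uIcc_of_le hT]
    refine ContinuousOn.div continuousOn_const (by fun_prop) fun σ hσ => ?_
    exact (Real.sqrt_pos.mpr (by linarith [hσ.1])).ne'
  rw [integral_eq_sub_of_hasDerivAt hderiv (hcont.intervalIntegrable)]
  simp only [add_zero, Real.sqrt_one, mul_one]
  linarith [Real.sqrt_nonneg (1 + T)]

/-- **Registered form (stub `stub_timeIntegrals` of the crux item)**: the mass integral and the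
smoothing integral of the caloric bootstrap. -/
theorem stub_timeIntegrals :
    ∀ (c T m : ℝ), 0 < c → 0 ≤ T →
      (∫ σ in (0:ℝ)..T, |m| * Real.exp (-(c * σ * m ^ 2)) ≤ Real.sqrt (T / c)) ∧
      (∫ σ in (0:ℝ)..T, 1 / Real.sqrt (1 + σ) ≤ 2 * Real.sqrt (1 + T)) :=
  fun _ _ m hc hT => ⟨integral_abs_mul_exp_neg_le hc hT m, integral_inv_sqrt_one_add_le hT⟩

end Summit.QuantumFields.QCD.Cruxes.SmallFieldUltracontractivity.PointCentredAxialParabolic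

end
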